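import Summits.BirchSwinnertonDyer.BirchSwinnertonDyer.Theorems.GenusKolyvaginAtTwoGenusPrimitiveSupplyAtTwoLoweringStep
import Summits.BirchSwinnertonDyer.BirchSwinnertonDyer.Theorems.GenusKolyvaginAtTwoGenusPrimitiveSupplyAtTwoTwinSupply
import Literature.NumberTheory.EllipticCurves.ExceptionalPrimesDensityModels
import Literature.NumberTheory.EllipticCurves.TwoAdicImageQuadraticTwistProofs
import HarnessLib

/-!
# Route `GenusKolyvaginAtTwo`, crux #2 `GenusPrimitiveSupplyAtTwo` (stmt-BirchSwinnertonDyer-22136):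
# stub A's TWIN SUPPLY with the Mazur–Rubin lowering step DISCHARGED — (SUPPLY) and stub A now rest on
# {Modularity, 2-parity, Cassels–Tate, Poitou–Tate (real places), Tate χ} + the rank-one 2-converse, all by name

Lead seat `bsd-line-gk2-p1` g8 (cell `bsd-f1-sign2`). THEOREMS ONLY (no definition, no named fact, no `sorry`); helper
`--supports stmt-BirchSwinnertonDyer-22136`; no item is closed; BSD is not proved by any of this.

WHY. gk2-p5 g0's `GenusKoly.minimalSelmerTwinSupply_of_lowering` / `stub_minimalTwinSupplyAtTwo_of_lowering_of_twoConverse`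
(p591445) prove the crux's registered stub A (`stub_minimalTwinSupplyAtTwo`: a Kolyvagin-(H2)-admissible Heegner field whose
twin `E^{(d_K)}` is `2`-Selmer-minimal) from Modularity, `2`-parity, Cassels–Tate, the `2`-converse and ONE more named print
input `hMR` = Mazur–Rubin 2010 Prop. 5.2 over `ℚ` (`MazurRubin2010.prop52_rat`). The companion file `…LoweringStep` PROVES
Prop. 5.2 for `ρ̄_{E,2}` onto, globally minimal `E`, modulo the two standard duality facts
(`GenusKolyLowering.prop52_of_hasSurjectiveModNGaloisRep`). The walk of p591445 applies `hMR` only to globally minimal models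
of twists of the habitat curve `W` — all with `ρ̄₂` onto (`hasSurjectiveModNGaloisRep_two_quadraticTwist_iff`,
`hasSurjectiveModNGaloisRep_smul_iff`) — so the proved form suffices. This file re-runs gk2-p5's walk and assembly VERBATIM
with `hMR` weakened to the twists of `W` (`…_of_loweringW`), and discharges it:

* `exists_twist_card_selmerGroup_two_of_loweringW`, `minimalSelmerTwinSupply_of_loweringW` — p591445's §2 / §5 with the
  hypothesis `hMRW` (lowering for globally minimal models of twists of `W` only);
* **`minimalSelmerTwinSupply_of_duality`** — (SUPPLY) for the habitat from `exists_isNewformOf`, `p_parity · 2`,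
  `exists_casselsTate_pairing`, `poitouTate_selmerStructure_duality_real ℚ`, `localEulerPoincareCharacteristic` (all PRINT,
  displayed) — `MazurRubin2010.prop52_rat` is NO LONGER an input of the twin supply;
* **`stub_minimalTwinSupplyAtTwo_of_duality_of_twoConverse`** — registered stub A VERBATIM modulo the same five print facts and
  the rank-one `2`-converse (OPEN, crux 19220; as in p591445).

References: [MazurRubin2010] Prop. 5.2 (proof, arXiv:0904.3709 p. 12), Lemma 3.6, Cor. 3.4 (i); [DokchitserDokchitserAnnals2010]
Thm. 1.4; [GrossLMS1991] §1 (p. 235); [MilneADT2006] I Thm. 4.10; [SilvermanAEC2009] VIII.8 Cor. 8.3, X.5 Cor. 5.4.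
-/

set_option linter.dupNamespace false -- tree convention: `Summit.BirchSwinnertonDyer.BirchSwinnertonDyer.Theorems` (summit = sub-problem)
set_option autoImplicit false

noncomputable section

open scoped AddSubgroup

namespace Summit.BirchSwinnertonDyer.BirchSwinnertonDyer.Theorems.GenusKolyLowering

open NumberField WeierstrassCurve IsDedekindDomain Literature.NumberTheory.EllipticCurves
  Literature.NumberTheory.EllipticCurves.ModularForms Literature.NumberTheory.QuadraticFields
  Literature.NumberTheory.GaloisRepresentations Literature.NumberTheory.GaloisCohomology
open Summit.BirchSwinnertonDyer.BirchSwinnertonDyer.Theorems.GenusKoly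

/-! ## §4 The walk with the lowering hypothesis restricted to the twists of `W` -/

/-- **The walk, lowering hypothesis for the twists of `W` only.** As `GenusKoly.exists_twist_card_selmerGroup_two_of_lowering`
(gk2-p5, p591445) VERBATIM, except that the lowering step `hMRW` is assumed only for globally minimal models of quadratic twists
of the fixed curve `W` (which is all the induction uses). [cite: MazurRubin2010, Prop. 5.2 (proof) and Thm. 1.7 (proof)] -/
theorem exists_twist_card_selmerGroup_two_of_loweringW (W : WeierstrassCurve ℚ) [W.IsElliptic]
    (hMRW : ∀ {d : ℚ}, d ≠ 0 → ∀ (V : WeierstrassCurve ℚ) [V.IsElliptic] [V.IsGloballyMinimal],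
      (∃ C : VariableChange ℚ, C • W.quadraticTwist d = V) →
      ∀ s : ℕ, Nat.card (V.selmerGroup 2) = 2 ^ s → 1 < s → ∀ m : ℕ, m ≠ 0 →
        ∃ p : ℕ, p.Prime ∧ (p : ℤ) ≡ 1 [ZMOD (m : ℤ)] ∧
          Nat.card ((V.quadraticTwist (p : ℚ)).selmerGroup 2) = 2 ^ (s - 2))
    (k : ℕ) :
    ∀ {d : ℚ}, d ≠ 0 → ∀ (V : WeierstrassCurve ℚ) [V.IsElliptic] [V.IsGloballyMinimal],
      (∃ C : VariableChange ℚ, C • W.quadraticTwist d = V) → Nat.card (V.selmerGroup 2) = 2 ^ (2 * k + 1) →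
      ∀ m : ℕ, m ≠ 0 →
        ∃ u : ℕ, Squarefree u ∧ (u : ℤ) ≡ 1 [ZMOD (m : ℤ)] ∧
          ∃ (V' : WeierstrassCurve ℚ) (_ : V'.IsElliptic) (_ : V'.IsGloballyMinimal),
            (∃ C : VariableChange ℚ, C • W.quadraticTwist (d * u) = V') ∧ Nat.card (V'.selmerGroup 2) = 2 := by
  induction k with
  | zero =>
    intro d hd V _ _ hV hSel m hm
    refine ⟨1, squarefree_one, Int.ModEq.refl _, V, inferInstance, inferInstance, ?_, by simpa using hSel⟩
    simpa using hV
  | succ k ih =>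
    intro d hd V _ _ hV hSel m hm
    obtain ⟨p, hp, hpm, hSelp⟩ := hMRW hd V hV (2 * (k + 1) + 1) hSel (by omega) m hm
    have hp0 : (p : ℚ) ≠ 0 := by exact_mod_cast hp.ne_zero
    obtain ⟨V₁, _, _, hV₁, hSel₁⟩ := exists_globallyMinimal_twist_of_twist W d V hV hp0
    have hk : 2 * (k + 1) + 1 - 2 = 2 * k + 1 := by omega
    have hSel₁' : Nat.card (V₁.selmerGroup 2) = 2 ^ (2 * k + 1) := by rw [hSel₁, hSelp, hk]
    have hmp : m * p ≠ 0 := mul_ne_zero hm hp.ne_zero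
    obtain ⟨u₁, hu₁, hu₁m, V', _, _, hV', hSel'⟩ :=
      ih (mul_ne_zero hd hp0) V₁ hV₁ hSel₁' (m * p) hmp
    have hu₁m' : (u₁ : ℤ) ≡ 1 [ZMOD (m : ℤ)] :=
      hu₁m.of_dvd (by exact_mod_cast Dvd.intro p rfl)
    have hu₁p : (u₁ : ℤ) ≡ 1 [ZMOD (p : ℤ)] :=
      hu₁m.of_dvd (by exact_mod_cast Dvd.intro_left m rfl)
    have hpu : ¬ p ∣ u₁ := fun h ↦ by
      have hdu : (p : ℤ) ∣ (u₁ : ℤ) := by exact_mod_cast h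
      have h1 : (p : ℤ) ∣ 1 := by simpa using Int.dvd_sub hdu (Int.ModEq.dvd hu₁p.symm)
      exact hp.one_lt.ne' (by exact_mod_cast Int.eq_one_of_dvd_one (by positivity) h1)
    refine ⟨p * u₁, ?_, ?_, V', inferInstance, inferInstance, ?_, hSel'⟩
    · exact (Nat.squarefree_mul (hp.coprime_iff_not_dvd.mpr hpu)).mpr ⟨hp.squarefree, hu₁⟩
    · have := hpm.mul hu₁m'
      simpa using this
    · simpa [mul_assoc] using hV'

/-- **The lowering hypothesis for the twists of a `ρ̄₂`-onto curve HOLDS, modulo {PT, Tate χ}**: every globally minimal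
model `V ≅ C • W^{(d)}` of a twist of `W` has `ρ̄_{V,2}` onto (`hasSurjectiveModNGaloisRep_two_quadraticTwist_iff`,
`hasSurjectiveModNGaloisRep_smul_iff`), so `prop52_of_hasSurjectiveModNGaloisRep` applies to it.
[cite: MazurRubin2010, Prop. 5.2] [cite: DokchitserDokchitserMathZ2012, Theorem (1)] -/
theorem loweringW_of_duality (hPT : poitouTate_selmerStructure_duality_real ℚ)
    (hEP : ∀ v : HeightOneSpectrum (𝓞 ℚ), localEulerPoincareCharacteristic (v.adicCompletion ℚ))
    (W : WeierstrassCurve ℚ) [W.IsElliptic] (hsurj : W.HasSurjectiveModNGaloisRep 2) :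
    ∀ {d : ℚ}, d ≠ 0 → ∀ (V : WeierstrassCurve ℚ) [V.IsElliptic] [V.IsGloballyMinimal],
      (∃ C : VariableChange ℚ, C • W.quadraticTwist d = V) →
      ∀ s : ℕ, Nat.card (V.selmerGroup 2) = 2 ^ s → 1 < s → ∀ m : ℕ, m ≠ 0 →
        ∃ p : ℕ, p.Prime ∧ (p : ℤ) ≡ 1 [ZMOD (m : ℤ)] ∧
          Nat.card ((V.quadraticTwist (p : ℚ)).selmerGroup 2) = 2 ^ (s - 2) := by
  intro d hd V _ _ hV s hSel hs m hm
  obtain ⟨C, rfl⟩ := hV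
  have hsurjV : (C • W.quadraticTwist d).HasSurjectiveModNGaloisRep 2 :=
    (hasSurjectiveModNGaloisRep_smul_iff (W.quadraticTwist d) C 2).mpr
      ((hasSurjectiveModNGaloisRep_two_quadraticTwist_iff W hd).mpr hsurj)
  exact prop52_of_hasSurjectiveModNGaloisRep hPT hEP (C • W.quadraticTwist d) hsurjV s hSel hs m hm

/-! ## §5 (SUPPLY) with the lowering step discharged -/

/-- **(SUPPLY) ⟸ lowering for the twists of `W` + Modularity + `2`-parity + Cassels–Tate** — gk2-p5's
`GenusKoly.minimalSelmerTwinSupply_of_lowering` (p591445) VERBATIM with `hMR` replaced by the per-curve hypothesis `hMRW`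
(only its instances at twists of the habitat curve are used). See that theorem's docstring for the construction (prime
`q₀ ≡ 7 (mod 8)`, `≡ −1 (mod q ∣ N)`, `> |Δ|`; Heegner twin of odd `2`-Selmer rank; the walk with modulus `8 q₀ N`; the field
`ℚ(√(−q₀u))`). [cite: MazurRubin2010, Prop. 5.2 (proof) with Lemma 3.6] [cite: DokchitserDokchitserAnnals2010, Thm. 1.4]
[cite: GrossLMS1991, §1 (p. 235)] -/
theorem minimalSelmerTwinSupply_of_loweringW (hmod : exists_isNewformOf)
    (hpar : ∀ V : WeierstrassCurve ℚ, p_parity V 2) (hCT : exists_casselsTate_pairing (K := ℚ))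
    (W : WeierstrassCurve ℚ) [W.IsElliptic] [W.IsGloballyMinimal] [NeZero (W.conductorNorm ℤ)]
    (hMRW : ∀ {d : ℚ}, d ≠ 0 → ∀ (V : WeierstrassCurve ℚ) [V.IsElliptic] [V.IsGloballyMinimal],
      (∃ C : VariableChange ℚ, C • W.quadraticTwist d = V) →
      ∀ s : ℕ, Nat.card (V.selmerGroup 2) = 2 ^ s → 1 < s → ∀ m : ℕ, m ≠ 0 →
        ∃ p : ℕ, p.Prime ∧ (p : ℤ) ≡ 1 [ZMOD (m : ℤ)] ∧
          Nat.card ((V.quadraticTwist (p : ℚ)).selmerGroup 2) = 2 ^ (s - 2))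
    (hr0 : W.analyticRank = 0) (hρ : ∀ n : ℕ, 0 < n → W.HasSurjectiveModNGaloisRep ((2 : ℤ) ^ n)) :
    ∃ (K : Type) (_ : Field K) (_ : NumberField K),
      IsImaginaryQuadratic K ∧ Odd (NumberField.discr K) ∧ NumberField.discr K ≠ -3 ∧
      SatisfiesHeegnerHypothesis (W.conductorNorm ℤ) K ∧
      ¬ IsSquare ((NumberField.discr K : ℚ) * -|W.Δ|) ∧ ¬ IsSquare ((NumberField.discr K : ℚ) * (-(2 * |W.Δ|))) ∧
      ∃ (Wd : WeierstrassCurve ℚ) (_ : Wd.IsElliptic) (_ : Wd.IsGloballyMinimal),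
        (∃ C : WeierstrassCurve.VariableChange ℚ, C • W.quadraticTwist (NumberField.discr K : ℚ) = Wd) ∧
        Nat.card (Wd.selmerGroup 2) = 2 := by
  have hN0 : (W.conductorNorm ℤ : ℕ) ≠ 0 := NeZero.ne _
  have hΔ : W.Δ ≠ 0 := W.isUnit_Δ.ne_zero
  -- Step 1: the auxiliary prime `q₀` and `K₀ = ℚ(√-q₀)`
  obtain ⟨q₀, K₀, _, _, hq₀, hq₀n, hq₀8, hq₀mod, h2K₀, hdiscK₀⟩ :=
    Quadratic.exists_prime_and_field_discr_eq_neg (W.conductorNorm ℤ : ℕ).primeFactors (max W.Δ.num.natAbs W.Δ.den)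
  haveI : Fact q₀.Prime := ⟨hq₀⟩
  have hq₀Z : ∀ p : ℕ, p.Prime → p ∣ (W.conductorNorm ℤ : ℕ) → (q₀ : ZMod p) = -1 := fun p hp hpN ↦
    hq₀mod p (Nat.mem_primeFactors.mpr ⟨hp, hpN, hN0⟩) hp.ne_zero
  have hK₀ : IsImaginaryQuadratic K₀ :=
    ⟨h2K₀, Quadratic.isTotallyComplex_of_discr_neg h2K₀ (by rw [hdiscK₀, neg_lt_zero]; exact_mod_cast hq₀.pos)⟩
  have hH₀ : SatisfiesHeegnerHypothesis (W.conductorNorm ℤ) K₀ := by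
    refine satisfiesHeegnerHypothesis_of_discr_congr h2K₀ _ hdiscK₀ (by omega) fun p hp hpN hp2 ↦ ?_
    rw [Int.cast_neg, Int.cast_natCast, hq₀Z p hp hpN, neg_neg]
  -- Step 2: a globally minimal model `W₀` of `W^{(-q₀)}` and its odd `2`-Selmer rank
  have hd₀ : (NumberField.discr K₀ : ℚ) ≠ 0 := by exact_mod_cast NumberField.discr_ne_zero K₀
  haveI := W.isElliptic_quadraticTwist hd₀
  obtain ⟨C₀, hC₀⟩ := hasGlobalMinimalModel_rat_holds (W.quadraticTwist (NumberField.discr K₀ : ℚ))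
  haveI := hC₀
  obtain ⟨k, hk⟩ := exists_card_selmerGroup_twin_eq_two_pow_odd hmod hpar hCT W hr0 (hρ 1 one_pos) K₀ hK₀ hH₀
    (C₀ • W.quadraticTwist (NumberField.discr K₀ : ℚ)) ⟨C₀, rfl⟩
  -- Step 3: the walk, modulus `m = 8 q₀ N`
  have hm : 8 * q₀ * (W.conductorNorm ℤ : ℕ) ≠ 0 := mul_ne_zero (mul_ne_zero (by norm_num) hq₀.ne_zero) hN0
  obtain ⟨u, hu, hum, Wd, _, _, hWd, hSel⟩ := exists_twist_card_selmerGroup_two_of_loweringW W hMRW k hd₀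
    (C₀ • W.quadraticTwist (NumberField.discr K₀ : ℚ)) ⟨C₀, rfl⟩ hk _ hm
  have hu0 : u ≠ 0 := hu.ne_zero
  have hu8 : (u : ℤ) ≡ 1 [ZMOD 8] := hum.of_dvd ⟨q₀ * (W.conductorNorm ℤ : ℕ), by push_cast; ring⟩
  have huq₀ : (u : ℤ) ≡ 1 [ZMOD q₀] := hum.of_dvd ⟨8 * (W.conductorNorm ℤ : ℕ), by push_cast; ring⟩
  have hq₀u : ¬ q₀ ∣ u := by
    intro h
    have hdu : (q₀ : ℤ) ∣ (u : ℤ) := by exact_mod_cast h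
    have h1 : (q₀ : ℤ) ∣ 1 := by simpa using Int.dvd_sub hdu (Int.ModEq.dvd huq₀.symm)
    exact hq₀.one_lt.ne' (by exact_mod_cast Int.eq_one_of_dvd_one (by positivity) h1)
  -- Step 4: the field `K = ℚ(√(-q₀ u))`
  set D : ℤ := -((q₀ : ℤ) * u) with hDdef
  have hD8 : D % 8 = 1 := neg_mul_emod_eight (by exact_mod_cast hq₀8) hu8
  have hDsq : Squarefree D := by
    rw [hDdef, ← Int.squarefree_natAbs]
    have : ((q₀ : ℤ) * u).natAbs = q₀ * u := by
      rw [Int.natAbs_mul, Int.natAbs_natCast, Int.natAbs_natCast]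
    rw [Int.natAbs_neg, this]
    exact (Nat.squarefree_mul (hq₀.coprime_iff_not_dvd.mpr hq₀u)).mpr ⟨hq₀.squarefree, hu⟩
  have hq₀7 : 7 ≤ q₀ := by omega
  have hDle : D ≤ -7 := by
    have : (7 : ℤ) * 1 ≤ (q₀ : ℤ) * u :=
      mul_le_mul (by exact_mod_cast hq₀7) (by exact_mod_cast Nat.one_le_iff_ne_zero.mpr hu0) zero_le_one
        (by positivity)
    omega
  obtain ⟨K, _, _, h2K, hdiscK⟩ := Quadratic.exists_numberField_discr_eq (D := D) (Or.inl ⟨hD8.symm ▸ by omega, hDsq, by omega⟩)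
  have hdiscKQ : (NumberField.discr K : ℚ) = (NumberField.discr K₀ : ℚ) * u := by
    rw [hdiscK, hdiscK₀, hDdef]; push_cast; ring
  -- `q₀`-adic valuations: `ord_{q₀}(q₀ · u · |Δ|) = 1`, `ord_{q₀}(2) = 0`
  have hq₀Q : (q₀ : ℚ) ≠ 0 := by exact_mod_cast hq₀.ne_zero
  have huQ : (u : ℚ) ≠ 0 := by exact_mod_cast hu0
  have hnum : ¬ (q₀ : ℤ) ∣ W.Δ.num := by
    intro h
    have h' : q₀ ∣ W.Δ.num.natAbs := Int.natCast_dvd.mp h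
    have hpos : 0 < W.Δ.num.natAbs := Int.natAbs_pos.mpr (Rat.num_ne_zero.mpr hΔ)
    have := Nat.le_of_dvd hpos h'
    omega
  have hden : ¬ q₀ ∣ W.Δ.den := by
    intro h
    have := Nat.le_of_dvd W.Δ.den_pos h
    omega
  have hvΔ : padicValRat q₀ W.Δ = 0 := by
    simp only [padicValRat, padicValInt.eq_zero_of_not_dvd hnum, padicValNat.eq_zero_of_not_dvd hden]
    simp
  have hvΔabs : padicValRat q₀ |W.Δ| = 0 := by
    rcases abs_choice W.Δ with h | h
    · rw [h, hvΔ]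
    · rw [h, padicValRat.neg, hvΔ]
  have hvu : padicValRat q₀ (u : ℚ) = 0 := by
    rw [padicValRat.of_nat, padicValNat.eq_zero_of_not_dvd hq₀u, Nat.cast_zero]
  have hv2 : padicValRat q₀ (2 : ℚ) = 0 := by
    have h2 : ¬ q₀ ∣ 2 := fun h ↦ by have := Nat.le_of_dvd two_pos h; omega
    rw [show (2 : ℚ) = ((2 : ℕ) : ℚ) by norm_num, padicValRat.of_nat, padicValNat.eq_zero_of_not_dvd h2,
      Nat.cast_zero]
  have hy0 : (q₀ : ℚ) * u * |W.Δ| ≠ 0 := mul_ne_zero (mul_ne_zero hq₀Q huQ) (abs_ne_zero.mpr hΔ)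
  have hy : padicValRat q₀ ((q₀ : ℚ) * u * |W.Δ|) = 1 := by
    rw [padicValRat.mul (mul_ne_zero hq₀Q huQ) (abs_ne_zero.mpr hΔ), padicValRat.mul hq₀Q huQ,
      padicValRat.self hq₀.one_lt, hvu, hvΔabs]
    simp
  refine ⟨K, inferInstance, inferInstance, ?_, ?_, ?_, ?_, ?_, ?_, Wd, inferInstance, inferInstance, ?_, hSel⟩
  · -- imaginary quadratic
    exact ⟨h2K, Quadratic.isTotallyComplex_of_discr_neg h2K (by rw [hdiscK]; omega)⟩
  · -- `d_K` odd
    rw [hdiscK, Int.odd_iff]; omega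
  · -- `d_K ≠ -3`
    rw [hdiscK]; omega
  · -- Heegner hypothesis
    refine satisfiesHeegnerHypothesis_of_discr_congr h2K _ hdiscK hD8 fun p hp hpN hp2 ↦ ?_
    have hpm : p ∣ 8 * q₀ * (W.conductorNorm ℤ : ℕ) := hpN.mul_left _
    have hup : ((u : ℤ) : ZMod p) = ((1 : ℤ) : ZMod p) := Quadratic.intCast_zmod_eq_of_modEq_of_dvd hum hpm
    rw [hDdef, Int.cast_neg, Int.cast_mul, Int.cast_natCast, hq₀Z p hp hpN, hup]
    push_cast; ring
  · -- `d_K · (−|Δ|)` is not a square: its `q₀`-adic valuation is `1`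
    have hx : (NumberField.discr K : ℚ) * -|W.Δ| = (q₀ : ℚ) * u * |W.Δ| := by rw [hdiscK, hDdef]; push_cast; ring
    rw [hx]
    exact not_isSquare_of_odd_padicValRat (q := q₀) hy0 (by rw [hy]; exact odd_one)
  · -- `d_K · (−2|Δ|)` is not a square: its `q₀`-adic valuation is `1`
    have hx : (NumberField.discr K : ℚ) * (-(2 * |W.Δ|)) = 2 * ((q₀ : ℚ) * u * |W.Δ|) := by
      rw [hdiscK, hDdef]; push_cast; ring
    rw [hx]
    refine not_isSquare_of_odd_padicValRat (q := q₀) (mul_ne_zero two_ne_zero hy0) ?_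
    rw [padicValRat.mul two_ne_zero hy0, hy, hv2, zero_add]
    exact odd_one
  · -- the twin
    rw [hdiscKQ]
    exact hWd

/-- **(SUPPLY) FOR THE HABITAT, MODULO FIVE STANDARD PRINT FACTS — Mazur–Rubin Prop. 5.2 DISCHARGED.** For `W/ℚ` globally
minimal, non-CM, `r_an(W) = 0`, `ρ_{W,2^n}` onto for all `n ≥ 1`: there are a Kolyvagin-(H2)-admissible Heegner field `K`
(imaginary quadratic, `d_K` odd `≠ −3`, every prime of `N_W` split, `d_K·(−|Δ|)` and `d_K·(−2|Δ|)` non-squares) and a globally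
minimal twin `Wd ≅ W^{(d_K)}` with `#Sel₂(Wd) = 2` — GRANTED ONLY Modularity `exists_isNewformOf` (BCDT), the `2`-parity theorem
`p_parity · 2` (Dokchitser–Dokchitser / Monsky), the Cassels–Tate pairing `exists_casselsTate_pairing`, Poitou–Tate duality with
real places `poitouTate_selmerStructure_duality_real ℚ` (Milne ADT I.4.10) and Tate's local Euler characteristic
`localEulerPoincareCharacteristic`. Compared with p591445 (`…_of_lowering`) the Mazur–Rubin input `hMR` (`prop52_rat`) is GONE:
it is the lead's kernel theorem `prop52_of_hasSurjectiveModNGaloisRep` (Lemma 3.6 + Čebotarev + the index-4 transfer + Lemma 2.11).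
The hypotheses `¬CM` and surjectivity beyond level `2` are idle. BSD is not proved by this.
[cite: MazurRubin2010, Prop. 5.2 (proof, arXiv:0904.3709 p. 12) with Lemma 3.6 and Cor. 3.4 (i)]
[cite: DokchitserDokchitserAnnals2010, Thm. 1.4] [cite: MilneADT2006, Ch. I, Thm. 4.10] [cite: GrossLMS1991, §1 (p. 235)] -/
theorem minimalSelmerTwinSupply_of_duality (hmod : exists_isNewformOf)
    (hpar : ∀ V : WeierstrassCurve ℚ, p_parity V 2) (hCT : exists_casselsTate_pairing (K := ℚ))
    (hPT : poitouTate_selmerStructure_duality_real ℚ)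
    (hEP : ∀ v : HeightOneSpectrum (𝓞 ℚ), localEulerPoincareCharacteristic (v.adicCompletion ℚ)) :
    ∀ (W : WeierstrassCurve ℚ) [W.IsElliptic] [W.IsGloballyMinimal] [NeZero (W.conductorNorm ℤ)],
      ¬ W.HasCM → W.analyticRank = 0 → (∀ n : ℕ, 0 < n → W.HasSurjectiveModNGaloisRep ((2 : ℤ) ^ n)) →
      ∃ (K : Type) (_ : Field K) (_ : NumberField K),
        IsImaginaryQuadratic K ∧ Odd (NumberField.discr K) ∧ NumberField.discr K ≠ -3 ∧
        SatisfiesHeegnerHypothesis (W.conductorNorm ℤ) K ∧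
        ¬ IsSquare ((NumberField.discr K : ℚ) * -|W.Δ|) ∧ ¬ IsSquare ((NumberField.discr K : ℚ) * (-(2 * |W.Δ|))) ∧
        ∃ (Wd : WeierstrassCurve ℚ) (_ : Wd.IsElliptic) (_ : Wd.IsGloballyMinimal),
          (∃ C : WeierstrassCurve.VariableChange ℚ, C • W.quadraticTwist (NumberField.discr K : ℚ) = Wd) ∧
          Nat.card (Wd.selmerGroup 2) = 2 := by
  intro W _ _ _ _hcm hr0 hρ
  have hsurj : W.HasSurjectiveModNGaloisRep 2 := by simpa using hρ 1 one_pos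
  exact minimalSelmerTwinSupply_of_loweringW hmod hpar hCT W (loweringW_of_duality hPT hEP W hsurj) hr0 hρ

/-! ## §6 Stub A modulo five print facts and the `2`-converse -/

/-- **STUB A ⟸ Modularity ∧ `2`-parity ∧ Cassels–Tate ∧ Poitou–Tate ∧ Tate χ ∧ (CONV₂).** The registered stub
`stub_minimalTwinSupplyAtTwo` of line `genus-supply` (crux 22136) VERBATIM from five PRINT facts (displayed) and the rank-one
`2`-converse `hconv` (OPEN, crux 19220, here without its reduction-type clause) — gk2-p5's
`stub_minimalTwinSupplyAtTwo_of_lowering_of_twoConverse` with the Mazur–Rubin lowering step PROVED (`minimalSelmerTwinSupply_of_duality`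
∘ the lead's `stub_minimalTwinSupplyAtTwo_of_twoConverse`). So stub A's only non-print input is the `2`-converse, and its print
inputs are the cell's five standard named facts. BSD is not proved by any of this.
[cite: MazurRubin2010, Prop. 5.2 (proof) with Lemma 3.6] [cite: DokchitserDokchitserAnnals2010, Thm. 1.4] -/
theorem stub_minimalTwinSupplyAtTwo_of_duality_of_twoConverse (hmod : exists_isNewformOf)
    (hpar : ∀ V : WeierstrassCurve ℚ, p_parity V 2) (hCT : exists_casselsTate_pairing (K := ℚ))
    (hPT : poitouTate_selmerStructure_duality_real ℚ)
    (hEP : ∀ v : HeightOneSpectrum (𝓞 ℚ), localEulerPoincareCharacteristic (v.adicCompletion ℚ))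
    (hconv : ∀ (V : WeierstrassCurve ℚ) [V.IsElliptic] [V.IsGloballyMinimal],
      ¬ V.HasCM → V.selmerCorank 2 = 1 → V.analyticRank = 1) :
    ∀ (W : WeierstrassCurve ℚ) [W.IsElliptic] [W.IsGloballyMinimal] [NeZero (W.conductorNorm ℤ)],
      ¬ W.HasCM → W.analyticRank = 0 → (∀ n : ℕ, 0 < n → W.HasSurjectiveModNGaloisRep ((2 : ℤ) ^ n)) →
      ∃ (K : Type) (_ : Field K) (_ : NumberField K),
        IsImaginaryQuadratic K ∧ Odd (NumberField.discr K) ∧ NumberField.discr K ≠ -3 ∧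
        SatisfiesHeegnerHypothesis (W.conductorNorm ℤ) K ∧
        ¬ IsSquare ((NumberField.discr K : ℚ) * -|W.Δ|) ∧ ¬ IsSquare ((NumberField.discr K : ℚ) * (-(2 * |W.Δ|))) ∧
        ∃ (Wd : WeierstrassCurve ℚ) (_ : Wd.IsElliptic) (_ : Wd.IsGloballyMinimal),
          (∃ C : WeierstrassCurve.VariableChange ℚ, C • W.quadraticTwist (NumberField.discr K : ℚ) = Wd) ∧
          Wd.analyticRank = 1 ∧ Nat.card (Wd.selmerGroup 2) = 2 :=
  stub_minimalTwinSupplyAtTwo_of_twoConverse hmod hpar hconv (minimalSelmerTwinSupply_of_duality hmod hpar hCT hPT hEP)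

end Summit.BirchSwinnertonDyer.BirchSwinnertonDyer.Theorems.GenusKolyLowering

end
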